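import Summits.ResolutionOfSingularities.ResolutionOfSingularities.Theorems.PurelyInseparableDim4Target
import Summits.ResolutionOfSingularities.ResolutionOfSingularities.Theorems.PurelyInseparableDim4LucasCeiling
import Literature.AlgebraicGeometry.Resolution.CentreBlowupMohStability
import Literature.AlgebraicGeometry.Resolution.CentreBlowupOrdAlongBasics
import Literature.AlgebraicGeometry.Resolution.OrdZeroBasics
import HarnessLib
import HarnessLib.Audit.Tags

/-!
# Purely inseparable fourfolds — the «d = 0 LEAF» STEP IN THE FIBRE (cell res-dim4-pi, WORD #38 (a)(2))
# [OURS · counted 0 · a statement about OUR coordinate-centre frame, not about resolution]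

Width seat `res-dim4-p-10` (g2), desk WORD #38 (a)(2) «d = 0 LEAF LEMMA».  A **leaf** (d = 0 state, the
combinatorial stage) is a presented state `s = (F, r, exc)` of the tree's coordinate-centre walk
(`CentreBlowup.CState`) with `x^r ∣ F`, `coeff_r F ≠ 0` (so `F = x^r · U`, `U(0) ≠ 0`, shade
`d = ord₀ F − |r| = 0`: `shade_eq_zero`) and `x^r` not a `q`-th power (automatic for a clean `F`).

THEOREM `leafStep_fibre` (any index type, any field, any `q ≥ 1`): blow up a CARDINALITY-FIRST
(MODE-1h, `IsMode1hCentre`) permissible coordinate centre of a leaf and pass to ANY equimultiple point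
`b` of the FIBRE over the origin (`b_j = 0`, `bᵢ = 0` off `S`; translations inside the exceptional fibre
allowed): the new state `CentreBlowup.step q S j b s` is a leaf and **`|r'| < |r|`**.  Hence
`no_infinite_fibre_chain`: the engines' convention «monomial(d = 0) = A-WIN» is a theorem of the
FIBRE game.  Mechanism (§2): ONE coefficient identity `coeff_pointTransform_leaf` — for every exponent
`D` agreeing with the chart exponent of `r` at the untranslated variables only the source `r`
contributes, `coeff_D F⁺ = c_r ∏ C(rᵢ, Dᵢ) bᵢ^{rᵢ−Dᵢ}`; with `D = r'` this is `≠ 0`, so equimultiplicity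
forces `r' = 0 ∨ |r'| ≥ q`, and `r' = 0` is excluded by the pure power `x_k^{r_k}` (`1 ≤ r_k < q`) of a
translated `k ∈ S`, resp. by cleanness when `b = 0`; cardinality-first gives `Σ_{S∖j} rᵢ < q` (the
drop) and, for `|S| ≥ 2`, all `rᵢ < q` (so `x^{r'}` is not a `q`-th power and survives the cleaning).

HONEST SCOPE (bus res-dim4, p-10 g2; specimens in `PurelyInseparableDim4LeafStepSpecimens`): the
conclusion FAILS for replies ALONG the centre (`bᵢ ≠ 0`, `i ∉ S`) — the unit may vanish there, or the
residual monomial may become a `q`-th power — so this is NOT a row rule for certificates whose reply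
set is every `K`-rational point (`InScopeWinCert`); it is the exact positive content of «d = 0 is
preserved and ord drops under cardinality-first».  Nothing here proves resolution of singularities in
dimension ≥ 4 / characteristic `p`; counted 0; AI work, weaker than expert review.
bears_on: LADDER-RESOLUTION:D157-DOOR2 (res-dim4-pi · WORD #38 (a)(2)). Supports
stmt-ResolutionOfSingularities-16155 (helper).
-/

set_option linter.dupNamespace false

open MvPolynomial Finset

open scoped BigOperators

noncomputable section

namespace Summit.ResolutionOfSingularities.ResolutionOfSingularities.Theorems.PIDim4

namespace LeafStep

open Literature.AlgebraicGeometry.Resolution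
open Literature.AlgebraicGeometry.Resolution.Hauser2010
open CentreBlowup

variable {σ : Type*} [Fintype σ] [DecidableEq σ] {K : Type*} [Field K] [DecidableEq K]

/-! ## 1. Leaf states: `F = x^r · unit` -/

omit [Fintype σ] [DecidableEq σ] [DecidableEq K] in
/-- Along any coordinate centre a leaf has order `Σ_{i∈S} rᵢ`. [cite: HauserPerlega2019PRIMS, §2 (ord_P)] -/
theorem ordAlong_eq_degIn (S : Finset σ) (s : CState σ K) (hdiv : ∀ d ∈ s.F.support, s.r ≤ d)
    (hd0 : coeff s.r s.F ≠ 0) : ordAlong S s.F = (degIn S s.r : ℕ∞) :=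
  le_antisymm (ordAlong_le_of_coeff_ne_zero hd0)
    (le_ordAlong_of_forall fun d hd => degIn_le_degIn_of_le S (hdiv d hd))

omit [DecidableEq σ] [DecidableEq K] in
/-- A leaf has order `|r|` at the origin. [cite: Hauser2010, §F (setting f = x^p + y^r g)] -/
theorem ordZero_eq_degree (s : CState σ K) (hdiv : ∀ d ∈ s.F.support, s.r ≤ d)
    (hd0 : coeff s.r s.F ≠ 0) : ordZero s.F = (s.r.degree : ℕ∞) := by
  rw [ordZero_eq_nat_iff]
  refine ⟨⟨s.r, hd0, rfl⟩, fun d hd => ?_⟩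
  by_contra hne
  have hle := PointBlowup.degree_le_degree_of_le (hdiv d (MvPolynomial.mem_support_iff.mpr hne))
  exact absurd hd (not_lt.mpr hle)

omit [DecidableEq σ] [DecidableEq K] in
/-- **A leaf has shade `d = 0`.** [cite: Hauser2010, §F (definition of the shade)] -/
theorem shade_eq_zero (s : CState σ K) (hdiv : ∀ d ∈ s.F.support, s.r ≤ d)
    (hd0 : coeff s.r s.F ≠ 0) : s.shade = 0 := by
  unfold CState.shade
  rw [ordZero_eq_degree s hdiv hd0, tsub_self]

/-! ## 2. The one coefficient identity -/

omit [DecidableEq K] in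
/-- **Only the source `r` contributes.** For a leaf, a chart `j ∈ S` with `q ≤ Σ_{i∈S} rᵢ`, a fibre
point `b` (`b_j = 0`, `bᵢ = 0` off `S`) and an exponent `D` with `Dᵢ = e(r)ᵢ` at every untranslated
variable (`e = chartExponent q S j`; no condition at the translated ones):
`coeff_D F⁺ = c_r · ∏ᵢ C(e(r)ᵢ, Dᵢ) bᵢ^{e(r)ᵢ − Dᵢ}`. [folklore] -/
theorem coeff_pointTransform_leaf (q : ℕ) {S : Finset σ} {j : σ} (hj : j ∈ S) {b : σ → K}
    (hbj : b j = 0) (hfib : ∀ i, i ∉ S → b i = 0) (s : CState σ K)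
    (hdiv : ∀ d ∈ s.F.support, s.r ≤ d) (hqS : q ≤ degIn S s.r) (D : σ →₀ ℕ)
    (hDoff : ∀ i, b i = 0 → D i = chartExponent q S j s.r i) :
    coeff D (pointTransform q S j b s) =
      coeff s.r s.F * ∏ i, (((chartExponent q S j s.r i).choose (D i) : K) *
        b i ^ (chartExponent q S j s.r i - D i)) := by
  rw [LucasCeiling.coeff_pointTransform]
  refine Finset.sum_eq_single s.r (fun d hd hne => ?_) (fun h => ?_)
  · -- a summand `d ≠ r` vanishes: otherwise `d = r`
    apply mul_eq_zero_of_right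
    by_contra hprod
    have hfac := Finset.prod_ne_zero_iff.mp hprod
    have hle : s.r ≤ d := hdiv d hd
    -- at an untranslated variable the exponent is pinned
    have key : ∀ i, b i = 0 → chartExponent q S j d i = chartExponent q S j s.r i := by
      intro i hbi
      have h := hfac i (Finset.mem_univ i)
      rw [LucasCeiling.factor_of_apply_eq_zero hbi] at h
      by_cases hDi : D i = chartExponent q S j d i
      · rw [← hDi, hDoff i hbi]
      · rw [if_neg hDi] at h
        exact absurd rfl h
    -- the `S`-degrees agree
    have hdegS : degIn S d = degIn S s.r := by
      have h := key j hbj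
      rw [chartExponent_apply_self, chartExponent_apply_self] at h
      have hmono := degIn_le_degIn_of_le S hle
      omega
    -- hence `d = r` on `S` …
    have honS : ∀ i ∈ S, d i = s.r i := by
      have hsum : ∑ i ∈ S, s.r i = ∑ i ∈ S, d i := hdegS.symm
      have := (Finset.sum_eq_sum_iff_of_le fun i _ => Finsupp.le_def.mp hle i).mp hsum
      exact fun i hi => (this i hi).symm
    -- … and off `S`
    apply hne
    ext i
    by_cases hi : i ∈ S
    · exact honS i hi
    · have hij : i ≠ j := fun h => hi (h ▸ hj)
      have h := key i (hfib i hi)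
      rwa [chartExponent_apply_of_ne q S hij, chartExponent_apply_of_ne q S hij] at h
  · rw [MvPolynomial.notMem_support_iff.mp h, zero_mul]

/-- **The new residual monomial has non-zero coefficient**: with `r' = e(r)` at the untranslated
variables and `0` at the translated ones, `coeff_{r'} F⁺ = c_r ∏_{bᵢ≠0} bᵢ^{rᵢ} ≠ 0`. [folklore] -/
theorem coeff_filter_chartExponent_ne_zero (q : ℕ) {S : Finset σ} {j : σ} (hj : j ∈ S) {b : σ → K}
    (hbj : b j = 0) (hfib : ∀ i, i ∉ S → b i = 0) (s : CState σ K)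
    (hdiv : ∀ d ∈ s.F.support, s.r ≤ d) (hd0 : coeff s.r s.F ≠ 0) (hqS : q ≤ degIn S s.r) :
    coeff ((chartExponent q S j s.r).filter fun i => b i = 0) (pointTransform q S j b s) ≠ 0 := by
  rw [coeff_pointTransform_leaf q hj hbj hfib s hdiv hqS _
    (fun i hbi => by rw [Finsupp.filter_apply, if_pos hbi])]
  refine mul_ne_zero hd0 (Finset.prod_ne_zero_iff.mpr fun i _ => ?_)
  by_cases hbi : b i = 0
  · rw [LucasCeiling.factor_of_apply_eq_zero hbi, Finsupp.filter_apply, if_pos hbi, if_pos rfl]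
    exact one_ne_zero
  · rw [Finsupp.filter_apply, if_neg hbi, Nat.choose_zero_right, Nat.cast_one, one_mul, Nat.sub_zero]
    exact pow_ne_zero _ hbi

/-- **The `r' = 0` obstruction.** If the new residual monomial is `1` and some `x_k` (`k ∈ S`) is
translated, then the pure power `x_k^{r_k}` occurs in `F⁺` (coefficient `c_r ∏_{i≠k} bᵢ^{rᵢ}`). [folklore] -/
theorem coeff_single_ne_zero_of_filter_eq_zero (q : ℕ) {S : Finset σ} {j : σ} (hj : j ∈ S)
    {b : σ → K} (hbj : b j = 0) (hfib : ∀ i, i ∉ S → b i = 0) (s : CState σ K)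
    (hdiv : ∀ d ∈ s.F.support, s.r ≤ d) (hd0 : coeff s.r s.F ≠ 0) (hqS : q ≤ degIn S s.r)
    (hE0 : ((chartExponent q S j s.r).filter fun i => b i = 0) = 0) {k : σ} (hbk : b k ≠ 0) :
    coeff (Finsupp.single k (s.r k)) (pointTransform q S j b s) ≠ 0 := by
  have hE : ∀ i, b i = 0 → chartExponent q S j s.r i = 0 := fun i hbi => by
    have := DFunLike.congr_fun hE0 i
    rwa [Finsupp.filter_apply, if_pos hbi] at this
  rw [coeff_pointTransform_leaf q hj hbj hfib s hdiv hqS _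
    (fun i hbi => by
      rw [hE i hbi, Finsupp.single_apply, if_neg (fun h : k = i => hbk (by rw [h]; exact hbi))])]
  refine mul_ne_zero hd0 (Finset.prod_ne_zero_iff.mpr fun i _ => ?_)
  by_cases hbi : b i = 0
  · rw [LucasCeiling.factor_of_apply_eq_zero hbi, hE i hbi, Finsupp.single_apply,
      if_neg (fun h : k = i => hbk (by rw [h]; exact hbi)), if_pos rfl]
    exact one_ne_zero
  · have hij : i ≠ j := fun h => hbi (h ▸ hbj)
    rw [chartExponent_apply_of_ne q S hij, Finsupp.single_apply]
    by_cases hki : k = i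
    · subst hki
      rw [if_pos rfl, Nat.choose_self, Nat.cast_one, one_mul, Nat.sub_self, pow_zero]
      exact one_ne_zero
    · rw [if_neg hki, Nat.choose_zero_right, Nat.cast_one, one_mul, Nat.sub_zero]
      exact pow_ne_zero _ hbi

/-! ## 3. Cardinality-first centres of a leaf -/

omit [Fintype σ] [DecidableEq K] in
/-- For a leaf, cardinality-first permissibility reads on the exponent `r`: `q ≤ Σ_{i∈S} rᵢ`, every
`S.erase k` is too small, and when a variable of `S∖j` exists all `rᵢ < q`. [folklore] -/
theorem degIn_erase_lt_of_least {q : ℕ} (hq : 0 < q) {S : Finset σ} (s : CState σ K)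
    (hdiv : ∀ d ∈ s.F.support, s.r ≤ d) (hd0 : coeff s.r s.F ≠ 0)
    (hleast : ∀ S' : Finset σ, S'.Nonempty → (q : ℕ∞) ≤ ordAlong S' s.F → S.card ≤ S'.card)
    {k : σ} (hk : k ∈ S) : degIn (S.erase k) s.r < q := by
  by_contra hge
  rw [not_lt] at hge
  by_cases hne : (S.erase k).Nonempty
  · have h := hleast (S.erase k) hne (by
      rw [ordAlong_eq_degIn _ s hdiv hd0]; exact_mod_cast hge)
    rw [Finset.card_erase_of_mem hk] at h
    have := Finset.card_pos.mpr ⟨k, hk⟩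
    omega
  · rw [Finset.not_nonempty_iff_eq_empty] at hne
    rw [hne, degIn_empty] at hge
    omega

omit [Fintype σ] [DecidableEq σ] [DecidableEq K] in
/-- If a cardinality-first centre has two elements then every `rᵢ < q`. [folklore] -/
theorem apply_lt_of_least {q : ℕ} {S : Finset σ} (s : CState σ K)
    (hdiv : ∀ d ∈ s.F.support, s.r ≤ d) (hd0 : coeff s.r s.F ≠ 0)
    (hleast : ∀ S' : Finset σ, S'.Nonempty → (q : ℕ∞) ≤ ordAlong S' s.F → S.card ≤ S'.card)
    {j k : σ} (hj : j ∈ S) (hk : k ∈ S) (hjk : k ≠ j) (i : σ) : s.r i < q := by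
  by_contra hge
  rw [not_lt] at hge
  have h := hleast {i} (Finset.singleton_nonempty i) (by
    rw [ordAlong_eq_degIn _ s hdiv hd0, degIn_singleton]; exact_mod_cast hge)
  rw [Finset.card_singleton] at h
  have : 1 < S.card := Finset.one_lt_card.mpr ⟨k, hk, j, hj, hjk⟩
  omega

/-! ## 4. THE LEAF STEP IN THE FIBRE -/

omit [Fintype σ] in
/-- The new multiplicity vector of a leaf step is the chart exponent of `r`, the translated
components dropped. [folklore] -/
theorem step_r_eq_filter (q : ℕ) {S : Finset σ} {j : σ} {b : σ → K} (hbj : b j = 0)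
    (s : CState σ K) (hdiv : ∀ d ∈ s.F.support, s.r ≤ d) (hd0 : coeff s.r s.F ≠ 0) :
    (step q S j b s).r = (chartExponent q S j s.r).filter fun i => b i = 0 := by
  rw [LucasCeiling.step_r, ordAlong_eq_degIn S s hdiv hd0, ENat.toNat_coe]
  unfold chartExponent
  rw [PointBlowup.filter_update_of_pos s.r (Z := fun i => b i = 0) hbj]

/-- **LEAF STEP IN THE FIBRE (cardinality-first centre).** For a leaf `s` (`x^r ∣ F`, `coeff_r F ≠ 0`,
`x^r` not a `q`-th power), a permissible centre `S` of least cardinality (MODE 1h), a chart `j ∈ S`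
and an EQUIMULTIPLE point `b` of the fibre over the origin (`b_j = 0`, `bᵢ = 0` off `S`), the new state
`s' = step q S j b s` is a leaf with `|r'| < |r|`:
`x^{r'} ∣ F'`, `coeff_{r'} F' ≠ 0`, `x^{r'}` not a `q`-th power, `|r'| < |r|`.
[OURS · counted 0] [cite: Hauser2010, §F (transform of f = x^p + y^r g under blowup)]
[cite: HauserPerlega2019PRIMS, §2 (the blowup in the x₁-chart; combinatorial case)] -/
theorem leafStep_fibre {q : ℕ} (hq : 0 < q) {S : Finset σ} {j : σ} (hj : j ∈ S) {b : σ → K}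
    (hbj : b j = 0) (hfib : ∀ i, i ∉ S → b i = 0) (s : CState σ K)
    (hdiv : ∀ d ∈ s.F.support, s.r ≤ d) (hd0 : coeff s.r s.F ≠ 0) (hcl : ¬ ∀ i, q ∣ s.r i)
    (hperm : (q : ℕ∞) ≤ ordAlong S s.F)
    (hleast : ∀ S' : Finset σ, S'.Nonempty → (q : ℕ∞) ≤ ordAlong S' s.F → S.card ≤ S'.card)
    (heq : IsEquimultiplePoint q S j b s) :
    (∀ d ∈ (step q S j b s).F.support, (step q S j b s).r ≤ d) ∧
      coeff (step q S j b s).r (step q S j b s).F ≠ 0 ∧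
      (¬ ∀ i, q ∣ (step q S j b s).r i) ∧
      (step q S j b s).r.degree < s.r.degree := by
  -- notation and the combinatorics of the centre
  set E : σ →₀ ℕ := (chartExponent q S j s.r).filter fun i => b i = 0 with hEdef
  have hqS : q ≤ degIn S s.r := by
    have h := hperm
    rw [ordAlong_eq_degIn S s hdiv hd0] at h
    exact_mod_cast h
  have hmin : ∀ k ∈ S, degIn (S.erase k) s.r < q :=
    fun k hk => degIn_erase_lt_of_least hq s hdiv hd0 hleast hk
  have hsplit : degIn S s.r = s.r j + degIn (S.erase j) s.r :=
    (Finset.add_sum_erase S (⇑s.r) hj).symm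
  have htrans : ∀ k, b k ≠ 0 → k ∈ S ∧ k ≠ j := fun k hbk =>
    ⟨by_contra fun h => hbk (hfib k h), fun h => hbk (h ▸ hbj)⟩
  have hEoff : ∀ i, b i = 0 → E i = chartExponent q S j s.r i := fun i hbi => by
    rw [hEdef, Finsupp.filter_apply, if_pos hbi]
  have hEon : ∀ i, b i ≠ 0 → E i = 0 := fun i hbi => by
    rw [hEdef, Finsupp.filter_apply, if_neg hbi]
  have hEj : E j = degIn S s.r - q := by rw [hEoff j hbj, chartExponent_apply_self]
  have hEi : ∀ i, i ≠ j → b i = 0 → E i = s.r i := fun i hij hbi => by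
    rw [hEoff i hbi, chartExponent_apply_of_ne q S hij]
  -- (A) the new residual monomial occurs in `F⁺`
  have hEne : coeff E (pointTransform q S j b s) ≠ 0 :=
    coeff_filter_chartExponent_ne_zero q hj hbj hfib s hdiv hd0 hqS
  -- (B) it is not `1`
  have hE0 : E ≠ 0 := by
    intro hE0
    by_cases hT : ∃ k, b k ≠ 0
    · obtain ⟨k, hbk⟩ := hT
      obtain ⟨hkS, hkj⟩ := htrans k hbk
      have hrk : 0 < s.r k := by
        by_contra h0
        have h0' : s.r k = 0 := by omega
        have h1 := hmin k hkS
        have h2 : degIn (S.erase k) s.r = degIn S s.r := by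
          have := (Finset.add_sum_erase S (⇑s.r) hkS)
          unfold degIn; omega
        omega
      have hlt : s.r k < q := apply_lt_of_least s hdiv hd0 hleast hj hkS hkj k
      exact coeff_single_ne_zero_of_filter_eq_zero q hj hbj hfib s hdiv hd0 hqS hE0 hbk
        (heq _ (Finsupp.single_ne_zero.mpr hrk.ne') (by rw [Finsupp.degree_single]; exact hlt))
    · push Not at hT
      apply hcl
      have hzero : ∀ i, i ≠ j → s.r i = 0 := fun i hij => by
        rw [← hEi i hij (hT i), hE0, Finsupp.coe_zero, Pi.zero_apply]
      have herase : degIn (S.erase j) s.r = 0 :=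
        degIn_eq_zero_iff.mpr fun i hi => hzero i (Finset.ne_of_mem_erase hi)
      have hj0 : E j = 0 := by rw [hE0, Finsupp.coe_zero, Pi.zero_apply]
      rw [hEj] at hj0
      have hrj : s.r j = q := by omega
      intro i
      by_cases hij : i = j
      · rw [hij, hrj]
      · rw [hzero i hij]; exact dvd_zero q
  -- (C) hence it has degree `≥ q` (equimultiplicity)
  have hdeg : q ≤ E.degree := by
    by_contra hlt
    exact hEne (heq E hE0 (not_le.mp hlt))
  -- (D) and it is not a `q`-th power
  have hnotpow : ¬ ∀ i, q ∣ E i := by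
    intro hdvd
    by_cases hT : ∃ k, b k ≠ 0
    · obtain ⟨k, hbk⟩ := hT
      obtain ⟨hkS, hkj⟩ := htrans k hbk
      have hlt : ∀ i, s.r i < q := apply_lt_of_least s hdiv hd0 hleast hj hkS hkj
      apply hE0
      ext i
      rw [Finsupp.coe_zero, Pi.zero_apply]
      by_cases hbi : b i = 0
      · by_cases hij : i = j
        · subst hij
          have h1 := hdvd i
          rw [hEj] at h1 ⊢
          have h2 := hmin i hj
          have h3 := hlt i
          have h4 : degIn S s.r - q < q := by omega
          exact Nat.eq_zero_of_dvd_of_lt h1 h4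
        · have h1 := hdvd i
          rw [hEi i hij hbi] at h1 ⊢
          exact Nat.eq_zero_of_dvd_of_lt h1 (hlt i)
      · exact hEon i hbi
    · push Not at hT
      apply hcl
      have hdiv' : ∀ i, i ≠ j → q ∣ s.r i := fun i hij => by
        have := hdvd i; rwa [hEi i hij (hT i)] at this
      have hsum : q ∣ degIn (S.erase j) s.r :=
        Finset.dvd_sum fun i hi => hdiv' i (Finset.ne_of_mem_erase hi)
      have hjq : q ∣ degIn S s.r := by
        have h := hdvd j
        rw [hEj] at h
        have : degIn S s.r = (degIn S s.r - q) + q := by omega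
        rw [this]; exact dvd_add h (dvd_refl q)
      intro i
      by_cases hij : i = j
      · subst hij
        rw [hsplit] at hjq
        exact (Nat.dvd_add_left hsum).mp hjq
      · exact hdiv' i hij
  -- the new multiplicity vector IS `E`
  have hr' : (step q S j b s).r = E := step_r_eq_filter q hbj s hdiv hd0
  have ho : ordZero s.F = (s.r.degree : ℕ∞) := ordZero_eq_degree s hdiv hd0
  refine ⟨?_, ?_, ?_, ?_⟩
  · -- `x^{r'} ∣ F'`
    refine newMult_le_of_mem_support_step q S j b hbj s ho hdiv fun d hd => ?_
    rw [Nat.sub_self, add_zero]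
    exact degIn_le_degIn_of_le S (hdiv d hd)
  · -- `coeff_{r'} F' ≠ 0`: the monomial survives the cleaning
    rw [hr']
    change coeff E (deletePthPowers q (pointTransform q S j b s)) ≠ 0
    rw [coeff_deletePthPowers, if_neg (fun h => hnotpow ((isPthPowerExponent_iff q E).mp h))]
    exact hEne
  · rw [hr']; exact hnotpow
  · -- `|r'| < |r|`
    rw [hr']
    have h1 : E ≤ chartExponent q S j s.r := fun i => by
      rw [hEdef, Finsupp.filter_apply]
      split_ifs
      · exact le_rfl
      · exact Nat.zero_le _
    have h2 := PointBlowup.degree_le_degree_of_le h1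
    have h3 := PointBlowup.degree_update_add s.r j (degIn S s.r - q)
    have h4 := hmin j hj
    change (chartExponent q S j s.r).degree + s.r j = s.r.degree + (degIn S s.r - q) at h3
    omega

end LeafStep

end Summit.ResolutionOfSingularities.ResolutionOfSingularities.Theorems.PIDim4

end
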